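import Summits.QuantumFields.YangMills.Theorems.PoincareLipschitzImproveOfCoreLetters
import Summits.QuantumFields.YangMills.Theorems.PoincareLipschitzSmallRangeOfOneStepSrc
import Summits.QuantumFields.YangMills.Theorems.PoincareLipschitzSphereMapOneStepLogFree
import Summits.QuantumFields.YangMills.Theorems.PoincareLipschitzKnitScaleLetters
import Summits.QuantumFields.YangMills.Theorems.PoincareLipschitzKnitDoorRowsLogFree
import Summits.QuantumFields.YangMills.Theorems.PoincareLipschitzKnitFlatTopScale
import HarnessLib

/-!
# Crux stmt-QuantumFields-19936 `UnitScaleTilt.HistoryTailL`, route crux `PoincareLipschitz.BlockLipschitzL` (stmt-QuantumFields-23533), K2 — K-4b «THE ORGAN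
# REDUCED TO ITS CORE»: `hImprove` (FROZEN v1 899858e5: the windowed, `log⁶`-weighted energy improvement) ⟸ `hImproveCore` (LEAD w1 g9 v0→v1 7446c95a:
# bounded normalised energy ⟹ small normalised energy at ONE comparable scale), by the LOG-FREE E→R door read as an ENERGY envelope at the centre

Cell `ym3-torus` (YM ladder rung R3 = continuum SU(2) Yang–Mills on the three-torus — a RUNG, NOT the Clay problem: not d = 4, not infinite volume, not a mass
gap); width seat `ym-ust-19936-w2` gen 12 (LEAD ym-ust-19936-w1 g9 2026-08-29T08:04:16Z «K-4 PENS: … w2 g12 (K-4 knit `hImprove_of_core : hImproveCore →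
⟨hImprove v1⟩`)»; my 08:06Z located point: the descent must carry a SCALE-DEPENDENT (Morrey-class) twist source — the door ✓p701912 — not a constant slack).
THEOREMS ONLY (def-free); `--supports stmt-QuantumFields-19936 --as helper`.  Composition of LANDED files: ✓`PoincareLipschitzSphereMapOneStepLogFree.
hLogFreeOneStep_holds` (★w5 g12: the log-free one-step improvement with constant slack, threshold `E_r ≤ ε₁r`), ✓`PoincareLipschitzImproveOfCoreLetters` (K-4a:
`oneStep_socket_logFree` over LEAD's K-2a ✓`flat_almostMin_const_slack`, and the pure-real rows), ✓`PoincareLipschitzSmallRangeOfOneStepSrc.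
geometricStep_of_oneStep_src` ∕ `morrey_at_centre_of_geometricStep_src` (px8 F6-S), ✓`PoincareLipschitzKnitDoorRowsLogFree.doorRows_logFree` (w2),
✓`PoincareLipschitzKnitLadderLetters.exists_ladder_top'` (px8), ✓`PoincareLipschitzKnitScaleLetters.exists_threshold_sq_of_scaleLoss` (w7),
✓`PoincareLipschitzKnitFlatTopScale.energy_le_two_mul_twist_add` (w7).  Nothing here proves `hImproveCore` (the K2 organ of record — NOT in print even in the
continuum without compactness; ℤ³ road = discrete Luckhaus + compactness, RULING g9-6), `hRegH`, a stub, `BlockLipschitzL`, `HistoryTailL` or a summit statement.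

THE PROOF.  Fix `Λ₀ ε₀ κ`.  Constants in order: `A` (✓`hLogFreeOneStep_holds`) → `m := ⌈32A⌉₊ + 2` → `ε := ¼(m²)⁻¹` → `ε₁(ε)` → `c_T` (✓`doorRows_logFree`)
→ `ε_c := ε₁∕(4m)` → `C_c, R_c` (`hImproveCore` at `(Λ₀, ε_c)`) → `κ′ := max κ (max K_req (2C_cm + 2))`, `K_req := (18ε₁m³C_c + 11664m⁴(√ε₁+1) + 750)∕ε₀`
→ `R₁` (✓`exists_threshold_sq_of_scaleLoss (2κ′)`) → `C₀ := max C_c ((2c_T)⁻¹ + 100m∕ε₁ + 2κ′)`, `R₀ := max R_c (max R₁ (max 64 (C_c(m+1))))`.  At `(z, R)`: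
the core gives `r₀` (`R ≤ C_cr₀`, `4r₀ ≤ R`, `E_τ(Q_{2r₀}) ≤ ε_cr₀`); ✓`exists_ladder_top'` gives `m^K ∈ ((2r₀−1)∕m, 2r₀−1]`; the flat top energy is `≤ ε₁m^K`
(`top_threshold_logFree`); the rows hold (`reg_row`: `τ₀m^K ≤ τ₀R∕2 ≤ (2C₀)⁻¹ ≤ c_T`); `oneStep_socket_logFree` ∘ ✓`geometricStep_of_oneStep_src` give the
ladder step at the centre; ✓`morrey_at_centre_of_geometricStep_src` gives `E(Q_ρ(z)) ≤ (m²E_top∕(m^K)² + 2m⁴N_s)(ρ+1)²` for every `0 ≤ ρ ≤ m^K` — read at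
`ρ := 2r_f`, `r_f := ⌊R∕(κ′log⁶R)⌋` (`R∕(κ′log⁶R) ≥ 2√R ≥ 16`; `window_radius`, `window_rows`, `two_rf_le_top`), where `twist_le_two_mul_flat_add` and
`final_row_logFree` give `E_τ(Q_{2r_f})·log⁶r_f ≤ ε₀r_f`, and the window `R ≤ 2κ′log⁶R·r_f ≤ C₀log⁶R·r_f`, `κlog⁶R·r_f ≤ R`, `Q_{2r_f} ⊆ Q_R`.
* ★★★ `hImprove_of_core (hCore : ⟨hImproveCore VERBATIM⟩) : ⟨hImprove v1 899858e5 VERBATIM⟩`.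
HONEST SCOPE.  A reduction between two displayed texts; YM₃ on T³ is rung R3, not Clay; YM gap NOT proved.

References: R. Schoen, K. Uhlenbeck, J. Diff. Geom. 17 (1982) 307–335 [SchoenUhlenbeck1982] (§4); M. Giaquinta, Annals of Math. Studies 105 (1983)
[Giaquinta1984] (Ch. III Lemma 2.1 p.86: Campanato∕Morrey iteration with an additive source).
-/

set_option autoImplicit false

noncomputable section

open scoped BigOperators InnerProductSpace
open Finset

namespace Summit.QuantumFields.YangMills.Theorems.PoincareLipschitzImproveOfCore

open Literature.MathematicalPhysics.QuantumFieldTheory.Balaban1983to89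
open B4Eq19LatticeOperators (Zd box unitVec mem_box box_mono box_subset_box self_mem_box add_unitVec_mem_box sub_unitVec_mem_box card_box)
open Summit.QuantumFields.YangMills.Theorems.PoincareLipschitzSmallRangeOfOneStepSrc (geometricStep_of_oneStep_src morrey_at_centre_of_geometricStep_src)
open Summit.QuantumFields.YangMills.Theorems.PoincareLipschitzSphereMapOneStepLogFree (hLogFreeOneStep_holds)
open Summit.QuantumFields.YangMills.Theorems.PoincareLipschitzKnitLadderLetters (exists_ladder_top' card_box_three)
open Summit.QuantumFields.YangMills.Theorems.PoincareLipschitzKnitScaleLetters (exists_threshold_sq_of_scaleLoss)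
open Summit.QuantumFields.YangMills.Theorems.PoincareLipschitzKnitDoorRowsLogFree (doorRows_logFree)
open Summit.QuantumFields.YangMills.Theorems.PoincareLipschitzKnitFlatTopScale (energy_le_two_mul_twist_add)
open Summit.QuantumFields.YangMills.Theorems.PoincareLipschitzImproveOfCoreLetters

/-! ## ★★★ The organ reduced to its core -/

-- hb 400000: composition-heavy knit (≈ 40 `obtain`∕cast steps over nine imported files); passes at the farm DEFAULT 200k, fails at 100k —
-- the 400k line is 2× lane headroom only (RULING №24 (a) ≤ 400k class, no word needed; v1.1: was 800k without a reason line, referee g92 flag)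
set_option maxHeartbeats 400000 in
/-- ★★★ **`hImprove ⟸ hImproveCore`** — the FROZEN organ text `hImprove` v1 (899858e5, VERBATIM: windowed, `log⁶`-weighted energy improvement) follows from
`hImproveCore` (LEAD w1 g9, 7446c95a, VERBATIM: small normalised energy at ONE comparable scale) by the LOG-FREE E→R door of the tree read as an energy
envelope at the centre (module docstring: the proof and the order of constants). [cite: SchoenUhlenbeck1982, §4; Giaquinta1984, Ch. III Lemma 2.1 p.86] -/
theorem hImprove_of_core
    (hCore : ∀ (Λ₀ ε₁ : ℝ), 0 < Λ₀ → 0 < ε₁ →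
      ∃ (C₀ R₀ : ℝ), 1 ≤ C₀ ∧ 1 ≤ R₀ ∧
      ∀ (u : Zd 3 → EuclideanSpace ℝ (Fin 4)) (τ : Fin 3 → Zd 3 → (EuclideanSpace ℝ (Fin 4) ≃ₗᵢ[ℝ] EuclideanSpace ℝ (Fin 4)))
      (z : Zd 3) (R : ℤ) (τ₀ : ℝ),
      R₀ ≤ R →
      (∀ y, ‖u y‖ = 1) →
      (∀ y ∈ box z (R + 1), ∀ (μ : Fin 3) (w : EuclideanSpace ℝ (Fin 4)), ‖τ μ y w - w‖ ≤ τ₀ * ‖w‖) →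
      τ₀ * (R : ℝ) ≤ C₀⁻¹ →
      (∀ y ∈ box z R,
      ‖∑ μ : Fin 3, (τ μ y (u (y + unitVec μ)) + (τ μ (y - unitVec μ)).symm (u (y - unitVec μ)))‖ • u y =
      ∑ μ : Fin 3, (τ μ y (u (y + unitVec μ)) + (τ μ (y - unitVec μ)).symm (u (y - unitVec μ)))) →
      (∀ (z' : Zd 3) (R' : ℤ), 0 ≤ R' → box z' (R' + 1) ⊆ box z R →
      ∀ v : Zd 3 → EuclideanSpace ℝ (Fin 4), (∀ y, y ∉ box z' R' → v y = u y) → (∀ y ∈ box z' R', ‖v y‖ = 1) →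
      ∑ y ∈ box z' (R' + 1), ∑ μ : Fin 3, ‖τ μ y (u (y + unitVec μ)) - u y‖ ^ 2 ≤
      ∑ y ∈ box z' (R' + 1), ∑ μ : Fin 3, ‖τ μ y (v (y + unitVec μ)) - v y‖ ^ 2) →
      (∑ y ∈ box z R, ∑ μ : Fin 3, ‖τ μ y (u (y + unitVec μ)) - u y‖ ^ 2 ≤ Λ₀ * R) →
      ∃ r : ℤ, 1 ≤ r ∧ (R : ℝ) ≤ C₀ * r ∧ 4 * r ≤ R ∧
      ∑ y ∈ box z (2 * r), ∑ μ : Fin 3, ‖τ μ y (u (y + unitVec μ)) - u y‖ ^ 2 ≤ ε₁ * r) :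
    ∀ (Λ₀ ε₀ κ : ℝ), 0 < Λ₀ → 0 < ε₀ → 1 ≤ κ →
    ∃ (C₀ R₀ : ℝ), 1 ≤ C₀ ∧ 1 ≤ R₀ ∧
    ∀ (u : Zd 3 → EuclideanSpace ℝ (Fin 4)) (τ : Fin 3 → Zd 3 → (EuclideanSpace ℝ (Fin 4) ≃ₗᵢ[ℝ] EuclideanSpace ℝ (Fin 4)))
    (z : Zd 3) (R : ℤ) (τ₀ : ℝ),
    R₀ ≤ R →
    (∀ y, ‖u y‖ = 1) →
    (∀ y ∈ box z (R + 1), ∀ (μ : Fin 3) (w : EuclideanSpace ℝ (Fin 4)), ‖τ μ y w - w‖ ≤ τ₀ * ‖w‖) →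
    τ₀ * (R : ℝ) ≤ C₀⁻¹ →
    (∀ y ∈ box z R,
    ‖∑ μ : Fin 3, (τ μ y (u (y + unitVec μ)) + (τ μ (y - unitVec μ)).symm (u (y - unitVec μ)))‖ • u y =
    ∑ μ : Fin 3, (τ μ y (u (y + unitVec μ)) + (τ μ (y - unitVec μ)).symm (u (y - unitVec μ)))) →
    (∀ (z' : Zd 3) (R' : ℤ), 0 ≤ R' → box z' (R' + 1) ⊆ box z R →
    ∀ v : Zd 3 → EuclideanSpace ℝ (Fin 4), (∀ y, y ∉ box z' R' → v y = u y) → (∀ y ∈ box z' R', ‖v y‖ = 1) →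
    ∑ y ∈ box z' (R' + 1), ∑ μ : Fin 3, ‖τ μ y (u (y + unitVec μ)) - u y‖ ^ 2 ≤
    ∑ y ∈ box z' (R' + 1), ∑ μ : Fin 3, ‖τ μ y (v (y + unitVec μ)) - v y‖ ^ 2) →
    (∑ y ∈ box z R, ∑ μ : Fin 3, ‖τ μ y (u (y + unitVec μ)) - u y‖ ^ 2 ≤ Λ₀ * R) →
    ∃ r : ℤ, 1 ≤ r ∧ (R : ℝ) ≤ C₀ * Real.log R ^ 6 * r ∧ κ * Real.log R ^ 6 * r ≤ R ∧
    box z (2 * r) ⊆ box z R ∧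
    (∑ y ∈ box z (2 * r), ∑ μ : Fin 3, ‖τ μ y (u (y + unitVec μ)) - u y‖ ^ 2) * Real.log r ^ 6 ≤ ε₀ * r := by
  classical
  intro Λ₀ ε₀ κ hΛ₀ hε₀ hκ1
  obtain ⟨A, hA0, hCA⟩ := hLogFreeOneStep_holds
  -- (0) the constants, in order
  obtain ⟨m, hm_def⟩ : ∃ m : ℕ, m = ⌈32 * A⌉₊ + 2 := ⟨_, rfl⟩
  have hm2 : 2 ≤ m := by rw [hm_def]; omega
  have hmA' : 32 * A ≤ (m : ℝ) := by
    have h1 : 32 * A ≤ (⌈32 * A⌉₊ : ℝ) := Nat.le_ceil _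
    have h2 : ((⌈32 * A⌉₊ : ℕ) : ℝ) ≤ (m : ℝ) := by rw [hm_def]; push_cast; linarith
    linarith
  have hm2R : (2 : ℝ) ≤ m := by exact_mod_cast hm2
  have hm0 : (0 : ℝ) < m := by linarith
  obtain ⟨ε, hε_def⟩ : ∃ ε : ℝ, ε = 1 / 4 * ((m : ℝ) ^ (3 - 1))⁻¹ := ⟨_, rfl⟩
  have hεpos : 0 < ε := by rw [hε_def]; positivity
  obtain ⟨ε₁, hε₁, hone⟩ := hCA ε hεpos
  obtain ⟨cT, hcT, hrows⟩ := doorRows_logFree hm2 hε₁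
  obtain ⟨εc, hεc_def⟩ : ∃ εc : ℝ, εc = ε₁ / (4 * m) := ⟨_, rfl⟩
  have hεc : 0 < εc := by rw [hεc_def]; positivity
  obtain ⟨Cc, Rc, hCc1, hRc1, hcore⟩ := hCore Λ₀ εc hΛ₀ hεc
  have hCc0 : 0 < Cc := by linarith
  obtain ⟨Kreq, hKreq_def⟩ : ∃ Kreq : ℝ,
      Kreq = (18 * ε₁ * (m : ℝ) ^ 3 * Cc + 11664 * (m : ℝ) ^ 4 * (Real.sqrt ε₁ + 1) + 750) / ε₀ := ⟨_, rfl⟩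
  obtain ⟨κ', hκ'_def⟩ : ∃ κ' : ℝ, κ' = max κ (max Kreq (2 * Cc * m + 2)) := ⟨_, rfl⟩
  have hκκ' : κ ≤ κ' := by rw [hκ'_def]; exact le_max_left _ _
  have hKκ' : Kreq ≤ κ' := by rw [hκ'_def]; exact (le_max_left _ _).trans (le_max_right _ _)
  have hCκ' : 2 * Cc * m + 2 ≤ κ' := by rw [hκ'_def]; exact (le_max_right _ _).trans (le_max_right _ _)
  have hCm0 : 0 ≤ 2 * Cc * (m : ℝ) := by positivity
  have hκ'2 : 2 ≤ κ' := by linarith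
  have hκ'1 : 1 ≤ κ' := by linarith
  have hκ'0 : 0 < κ' := by linarith
  have hCκ'' : 2 * Cc * m ≤ κ' := by linarith
  obtain ⟨R₁, hR₁, hsq⟩ := exists_threshold_sq_of_scaleLoss (2 * κ')
  refine ⟨max Cc (1 / (2 * cT) + 100 * m / ε₁ + 2 * κ'), max Rc (max R₁ (max 64 (Cc * ((m : ℝ) + 1)))),
    le_trans hCc1 (le_max_left _ _), le_trans hRc1 (le_max_left _ _), ?_⟩
  intro u τ z R τ₀ hR hu hdef hτR hopt hloc hE
  -- (1) sizes
  set C₀ : ℝ := max Cc (1 / (2 * cT) + 100 * m / ε₁ + 2 * κ') with hC₀_def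
  have hC₀Cc : Cc ≤ C₀ := le_max_left _ _
  have hC₀b : 1 / (2 * cT) + 100 * m / ε₁ + 2 * κ' ≤ C₀ := le_max_right _ _
  have hC₀1 : 1 ≤ C₀ := hCc1.trans hC₀Cc
  have hC₀0 : 0 < C₀ := by linarith
  have hpos1 : 0 ≤ 1 / (2 * cT) := by positivity
  have hpos2 : 0 ≤ 100 * (m : ℝ) / ε₁ := by positivity
  have hC₀cT : 1 / (2 * cT) ≤ C₀ := by linarith
  have hC₀m : 100 * m / ε₁ ≤ C₀ := by linarith
  have hC₀κ : 2 * κ' ≤ C₀ := by linarith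
  have hRRc : Rc ≤ (R : ℝ) := le_trans (le_max_left _ _) hR
  have hRR₁ : R₁ ≤ (R : ℝ) := le_trans ((le_max_left _ _).trans (le_max_right _ _)) hR
  have hR64 : (64 : ℝ) ≤ R := le_trans (((le_max_left _ _).trans (le_max_right _ _)).trans (le_max_right _ _)) hR
  have hRCm : Cc * ((m : ℝ) + 1) ≤ R := le_trans (((le_max_right _ _).trans (le_max_right _ _)).trans (le_max_right _ _)) hR
  have hRpos : (0 : ℝ) < R := by linarith
  have hR0int : (0 : ℤ) ≤ R := by exact_mod_cast hRpos.le
  -- `0 ≤ τ₀` from the defect row at the centre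
  have hτ0 : 0 ≤ τ₀ := by
    have h := hdef z (self_mem_box z (by linarith)) 0 (u z)
    rw [hu z, mul_one] at h
    exact le_trans (norm_nonneg _) h
  have hτRc : τ₀ * (R : ℝ) ≤ Cc⁻¹ := hτR.trans ((inv_le_inv₀ hC₀0 hCc0).mpr hC₀Cc)
  have hτR1 : τ₀ * (R : ℝ) ≤ 1 := hτR.trans (inv_le_one_of_one_le₀ hC₀1)
  -- (2) the core at `(z, R)`
  obtain ⟨r₀, hr₀1, hRle, h4r, hsmall⟩ := hcore u τ z R τ₀ hRRc hu hdef hτRc hopt hloc hE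
  have hr₀R : (1 : ℝ) ≤ r₀ := by exact_mod_cast hr₀1
  have hr₀0 : (0 : ℝ) < r₀ := by linarith
  have h4rR : 4 * (r₀ : ℝ) ≤ R := by exact_mod_cast h4r
  have hr₀m : (m : ℝ) + 1 ≤ r₀ := le_of_mul_le_mul_left (hRCm.trans hRle) hCc0
  have hmr_int : (m : ℤ) ≤ 2 * r₀ - 1 := by
    have : (m : ℝ) ≤ 2 * (r₀ : ℝ) - 1 := by linarith
    exact_mod_cast this
  have hsub2r : box z (2 * r₀) ⊆ box z R := box_mono z (by linarith)
  have hsub2r1 : box z (2 * r₀) ⊆ box z (R + 1) := hsub2r.trans (box_mono z (by linarith))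
  -- (3) the ladder
  obtain ⟨K, _, hKlt, hKle, hM2⟩ := exists_ladder_top' hm2 hmr_int
  have hMR : ((m : ℝ)) ^ K ≤ 2 * r₀ - 1 := by exact_mod_cast hKle
  have hMRR2 : ((m : ℝ)) ^ K ≤ R / 2 := by linarith
  have hMRR : ((m : ℝ)) ^ K ≤ R := by linarith
  have hM1 : (1 : ℝ) ≤ (m : ℝ) ^ K := by
    have : (2 : ℝ) ≤ (m : ℝ) ^ K := by exact_mod_cast hM2
    linarith
  have hM0 : (0 : ℝ) < (m : ℝ) ^ K := by linarith
  have hrM : (r₀ : ℝ) / m ≤ (m : ℝ) ^ K := by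
    have h1 : (r₀ : ℝ) / m ≤ ((2 * r₀ - 1 : ℤ) : ℝ) / m := by
      refine div_le_div_of_nonneg_right ?_ hm0.le; push_cast; linarith
    linarith
  have hRCM : (R : ℝ) / (Cc * m) ≤ (m : ℝ) ^ K := by
    have h1 : (R : ℝ) / (Cc * m) ≤ (Cc * r₀) / (Cc * m) := div_le_div_of_nonneg_right hRle (by positivity)
    have e1 : (Cc * (r₀ : ℝ)) / (Cc * m) = r₀ / m := by field_simp
    linarith
  -- (4) letters `E, T, s` and the rows in their regime
  obtain ⟨E, hE_def⟩ : ∃ E : Zd 3 → ℤ → ℝ, E = fun x ρ => ∑ y ∈ box x ρ, ∑ μ, ‖u (y + unitVec μ) - u y‖ ^ 2 := ⟨_, rfl⟩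
  obtain ⟨T, hT_def⟩ : ∃ T : ℤ → ℝ, T = fun ρ : ℤ => ε₁ * (ρ : ℝ) := ⟨_, rfl⟩
  obtain ⟨s, hs_def⟩ : ∃ s : ℤ → ℝ, s = fun ρ : ℤ => 2 * (4 * τ₀ * Real.sqrt (3 * (2 * (ρ : ℝ) + 1) ^ 3 * T ρ) + 2 * τ₀ ^ 2 * (3 * (2 * (ρ : ℝ) + 1) ^ 3)) :=
    ⟨_, rfl⟩
  have hEap : ∀ x ρ, E x ρ = ∑ y ∈ box x ρ, ∑ μ, ‖u (y + unitVec μ) - u y‖ ^ 2 := fun x ρ => by rw [hE_def]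
  have hTap : ∀ ρ : ℤ, T ρ = ε₁ * ρ := fun ρ => by rw [hT_def]
  have hsap : ∀ ρ : ℤ, s ρ = 2 * (4 * τ₀ * Real.sqrt (3 * (2 * (ρ : ℝ) + 1) ^ 3 * T ρ) + 2 * τ₀ ^ 2 * (3 * (2 * (ρ : ℝ) + 1) ^ 3)) :=
    fun ρ => by rw [hs_def]
  have hreg : τ₀ * (m : ℝ) ^ K ≤ cT := reg_row hτ0 hMRR2 hτR hC₀0 hcT hC₀cT
  obtain ⟨hT, hS⟩ := hrows τ₀ K T s hτ0 (fun ρ _ => hTap ρ) (fun ρ _ => (hsap ρ).le) hreg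
  have hE0 : ∀ x ρ, 0 ≤ E x ρ := fun x ρ => by rw [hEap]; exact Finset.sum_nonneg fun _ _ => Finset.sum_nonneg fun _ _ => sq_nonneg _
  have hEmono : ∀ x x' (ρ ρ' : ℤ), box x ρ ⊆ box x' ρ' → E x ρ ≤ E x' ρ' := fun x x' ρ ρ' h => by
    rw [hEap, hEap]; exact Finset.sum_le_sum_of_subset_of_nonneg h fun _ _ _ => Finset.sum_nonneg fun _ _ => sq_nonneg _
  -- (5) the socket at the centre and the ladder step
  have honeD : ∀ ρ r' : ℤ, 1 ≤ ρ → ρ + 1 ≤ r' → r' ≤ (m : ℤ) ^ K → E z r' ≤ T r' →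
      E z ρ ≤ (A * (((ρ : ℝ) + 1) / r') ^ 3 + ε) * E z r' + s r' := by
    intro ρ r' hρ hρr' hr'M hEr'
    rw [hEap, hTap] at hEr'
    rw [hEap, hEap, hsap, hTap]
    exact oneStep_socket_logFree hone u τ z hτ0 hu hdef hloc hsub2r hKle z (self_mem_box z (by norm_num)) ρ r' hρ hρr' hr'M hEr'
  have hmA : (2 : ℝ) ^ (3 + 2) * A ≤ m := by norm_num; linarith
  have hε : ε ≤ 1 / 4 * ((m : ℝ) ^ (3 - 1))⁻¹ := hε_def.le
  have hstep := geometricStep_of_oneStep_src (d := 3) (by norm_num) (E z) T s (hE0 z) hA0 hm2 hmA hε K honeD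
  -- (6) the top of the ladder below the threshold
  have hEtop1 : E z ((m : ℤ) ^ K) ≤ E z (2 * r₀) := hEmono z z _ _ (box_mono z (by linarith [hKle]))
  have hflat := energy_le_two_mul_twist_add τ (box z (2 * r₀)) (fun y hy μ w => hdef y (hsub2r1 hy) μ w) u (fun y _ μ => hu _)
  rw [← hEap] at hflat
  have hcard2r : ((box z (2 * r₀)).card : ℝ) ≤ 125 * (r₀ : ℝ) ^ 3 := by
    rw [card_box_three z (by linarith)]; push_cast
    calc (2 * (2 * (r₀ : ℝ)) + 1) ^ 3 ≤ (5 * (r₀ : ℝ)) ^ 3 := pow_le_pow_left₀ (by positivity) (by linarith) 3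
      _ = 125 * (r₀ : ℝ) ^ 3 := by ring
  have hEtop2 : E z ((m : ℤ) ^ K) ≤ 2 * (∑ y ∈ box z (2 * r₀), ∑ μ : Fin 3, ‖τ μ y (u (y + unitVec μ)) - u y‖ ^ 2) +
      750 * τ₀ ^ 2 * (r₀ : ℝ) ^ 3 := by
    have h3 : 2 * τ₀ ^ 2 * (((3 : ℕ) : ℝ) * ((box z (2 * r₀)).card : ℝ)) ≤ 750 * τ₀ ^ 2 * (r₀ : ℝ) ^ 3 := by
      have := mul_le_mul_of_nonneg_left hcard2r (show 0 ≤ 6 * τ₀ ^ 2 by positivity)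
      calc 2 * τ₀ ^ 2 * (((3 : ℕ) : ℝ) * ((box z (2 * r₀)).card : ℝ)) = 6 * τ₀ ^ 2 * ((box z (2 * r₀)).card : ℝ) := by push_cast; ring
        _ ≤ 6 * τ₀ ^ 2 * (125 * (r₀ : ℝ) ^ 3) := this
        _ = 750 * τ₀ ^ 2 * (r₀ : ℝ) ^ 3 := by ring
    linarith
  have hsmall' : (∑ y ∈ box z (2 * r₀), ∑ μ : Fin 3, ‖τ μ y (u (y + unitVec μ)) - u y‖ ^ 2) ≤ ε₁ / (4 * m) * r₀ := by
    rw [← hεc_def]; exact hsmall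
  have hτr₀ : τ₀ * (r₀ : ℝ) ≤ 1 / (4 * C₀) := tau_r0_le hτ0 h4rR hτR hC₀0
  have hEtop : E z ((m : ℤ) ^ K) ≤ ε₁ * (m : ℝ) ^ K :=
    top_threshold_logFree hε₁ hm2R hr₀R hrM hsmall' hτ0 hτr₀ hC₀1 hC₀m hEtop2
  have htop : E z ((m : ℤ) ^ K) ≤ T ((m : ℤ) ^ K) := by rw [hTap]; push_cast; exact hEtop
  -- (7) the Morrey envelope at the centre
  obtain ⟨Ns, hNs_def⟩ : ∃ Ns : ℝ, Ns = 324 * (τ₀ * Real.sqrt ε₁ + τ₀ ^ 2 * (m : ℝ) ^ K) := ⟨_, rfl⟩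
  have hNs0 : 0 ≤ Ns := by rw [hNs_def]; positivity
  have hS' : ∀ k, 1 ≤ k → k ≤ K → s ((m : ℤ) ^ k) ≤ Ns * ((m : ℝ) ^ (3 - 1)) ^ k := by
    intro k hk hkK; rw [hNs_def]; exact hS k hk hkK
  have hmor := morrey_at_centre_of_geometricStep_src E z (hE0 z) (fun ρ ρ' h => hEmono z z ρ ρ' (box_mono z h)) T s hm2 K hNs0
    hT hS' hstep htop
  -- (8) the window radius `r_f = ⌊R∕(κ′log⁶R)⌋`
  obtain ⟨L, hL_def⟩ : ∃ L : ℝ, L = Real.log (R : ℝ) ^ 6 := ⟨_, rfl⟩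
  have hlogR1 : 1 ≤ Real.log (R : ℝ) := by
    rw [Real.le_log_iff_exp_le hRpos]; have := Real.exp_one_lt_d9; linarith
  have hL1 : 1 ≤ L := by rw [hL_def]; exact one_le_pow₀ hlogR1
  have hL0 : 0 < L := by linarith
  obtain ⟨x, hx_def⟩ : ∃ x : ℝ, x = (R : ℝ) / (κ' * L) := ⟨_, rfl⟩
  have hx0 : 0 < x := by rw [hx_def]; positivity
  have hxR : (R : ℝ) = κ' * L * x := by rw [hx_def]; field_simp
  have hx16 : 16 ≤ x := by
    have e1 : 2 * κ' * Real.log (R : ℝ) ^ 6 * (x / 2) = κ' * L * x := by rw [hL_def]; ring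
    have h1 : (R : ℝ) ≤ 2 * κ' * Real.log (R : ℝ) ^ 6 * (x / 2) := by rw [e1]; exact hxR.le
    exact sixteen_le_of_sq hR64 (hsq R (x / 2) hRR₁ (by positivity) h1) hx0
  obtain ⟨rf, hrfx, hxrf⟩ := window_radius (show (2 : ℝ) ≤ x by linarith)
  have hrf8 : (8 : ℝ) ≤ rf := by linarith
  have hrf1R : (1 : ℝ) ≤ rf := by linarith
  have hrf1 : (1 : ℤ) ≤ rf := by exact_mod_cast hrf1R
  have hrf0 : (0 : ℝ) < rf := by linarith
  obtain ⟨hrfL, hRwin, h2rfR⟩ := window_rows hxR hrfx hxrf hκ'2 hL1 hx0.le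
  have hrfR' : (rf : ℝ) ≤ R := by linarith
  have hsubf : box z (2 * rf) ⊆ box z R := box_mono z (by exact_mod_cast h2rfR)
  have hsubf1 : box z (2 * rf) ⊆ box z (R + 1) := hsubf.trans (box_mono z (by linarith))
  have h2rfM : 2 * (rf : ℝ) ≤ (m : ℝ) ^ K := two_rf_le_top hrfx hx_def hL1 hκ'0 hRpos.le hRle hCc0 hr₀0.le hm0 hCκ'' hrM
  have h2rfM_int : (2 * rf : ℤ) ≤ (m : ℤ) ^ K := by exact_mod_cast h2rfM
  have hmorf := hmor (2 * rf) (by linarith) h2rfM_int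
  -- (9) the twisted energy at `2r_f` and the read-off
  have htw := twist_le_two_mul_flat_add τ hτ0 (box z (2 * rf)) (fun y hy μ w => hdef y (hsubf1 hy) μ w) u (fun y _ μ => hu _)
  rw [← hEap] at htw
  have hcardf : (((3 : ℕ) : ℝ) * ((box z (2 * rf)).card : ℝ)) = 3 * (2 * (2 * (rf : ℝ)) + 1) ^ 3 := by
    rw [card_box_three z (by linarith)]; push_cast; ring
  rw [hcardf] at htw
  have e31 : (3 - 1 : ℕ) = 2 := rfl
  have ecast : (((2 * rf : ℤ) : ℝ) + 1) = 2 * (rf : ℝ) + 1 := by push_cast; ring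
  rw [e31, ecast] at hmorf
  have hlf : Real.log (rf : ℝ) ^ 6 ≤ L := by
    rw [hL_def]; exact pow_le_pow_left₀ (Real.log_nonneg hrf1R) (Real.log_le_log hrf0 hrfR') 6
  have hfinal := final_row_logFree hε₀ hε₁ hm2R hCc1 hκ'1 (by rw [← hKreq_def]; exact hKκ') hRpos hL1 hrf1R hrfL
    (by positivity) hlf hτ0 hτR1 hRCM hMRR hM0 hEtop hNs_def hmorf htw
  -- (10) the window
  refine ⟨rf, hrf1, ?_, ?_, hsubf, hfinal⟩
  · -- `R ≤ C₀·log⁶R·r_f`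
    have h1 : 2 * κ' * L * rf ≤ C₀ * L * rf := by
      have := mul_le_mul_of_nonneg_right hC₀κ (by positivity : (0 : ℝ) ≤ L * rf)
      linarith [show 2 * κ' * L * rf = 2 * κ' * (L * rf) by ring, show C₀ * L * rf = C₀ * (L * rf) by ring]
    rw [← hL_def]; linarith
  · -- `κ·log⁶R·r_f ≤ R`
    have h1 : κ * L * rf ≤ κ' * L * rf := mul_le_mul_of_nonneg_right (mul_le_mul_of_nonneg_right hκκ' hL0.le) hrf0.le
    rw [← hL_def]; linarith [show κ' * L * (rf : ℝ) = rf * L * κ' by ring]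

end Summit.QuantumFields.YangMills.Theorems.PoincareLipschitzImproveOfCore

end
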